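/-
Origin: expansion seat `planner-pub-hodgecm-qw8-g3-0`, handover #3 2026-08-18T05:16:51Z (`HOME/pub-hodgecm-qw8-g3/Qw8g3/OpenInputsGeometric.lean`, md5 006336b8, 103 lines);
landed by the gen-6 packager in gate run 22 as `HodgeCM/Assembly/OpenInputsGeometric.lean` (import ^import Qw8g[0-9]+\.→import HodgeCM.StubTree. ×1).
-/
/-
Copyright: HodgeCMPerL cell, unit pub-hodgecm-qw8-g3 (planner-pub-hodgecm-qw8-g3-0), 2026-08-18.
Proposed landing path: `HodgeCM/Assembly/OpenInputsGeometric.lean`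
(import rewrite on landing: `Qw8g3.Qw8MilneZero` → `HodgeCM.StubTree.Qw8MilneZero`).
-/
import Summits.HodgeConjecture.HodgeCM.StubTree.Qw8MilneZero

/-!
# The record of open inputs with the CM side replaced by standard facts

`HodgeCM.Universe.OpenInputs` (StubTree/Inputs.lean) lists the four named open inputs of the headline
theorems: `realisation_perL`, `realisation_face` (PerL side) and `pohlmann_span`, `qw8_sufficiency`
(CM side).  Both CM-side inputs are now KERNEL THEOREMS of the model axioms and standard facts:

* `Universe.pohlmannSpan_of_facts (M) (hN1) (hN2) (hN3) (hN4) : U.PohlmannSpan`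
  (Proofs/Pohlmann/WeightHodge.lean, gate run 20; N1–N4 = `Fact_cupExterior`, `Fact_cup_hodge`,
  `Fact_pull_H0`, `Fact_hodge_F0`, Geometry/CupFacts.lean);
* `Universe.qw8Sufficiency_of_geometricFacts (M) (hN1) … (hN4) (h2) (h4) (h5) (h6) (h7) : U.Qw8Sufficiency`
  (StubTree/Qw8MilneZero.lean, qw8-g3; F2, F4–F7 = `Fact_factorActDescends`, `Fact_cupAlg`,
  `Fact_cupAssoc`, `Fact_weightDual`, `Fact_gysin`, StubTree/Qw8Geometric.lean) — no Milne 1999, no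
  [QW8], no fundamental-class axiom.

This file records the resulting finer record `Universe.OpenInputsGeometric` — the two PerL-side inputs
plus the nine standard facts (class-M candidates in the sense of FACTS.md §1c: published textbook facts
about the intended model, pending the referees' model-fact ruling; none of them mentions algebraicity of a
Hodge class of the varieties in question) — together with the map to the old record and the two headline
theorems from it.  Nothing here is new mathematics; it is the bookkeeping step "every discharged input
becomes a theorem replacing the hypothesis in `OpenInputs`" for `pohlmann_span` and `qw8_sufficiency`.
-/

noncomputable section

namespace HodgeCM

namespace Universe

variable (U : Universe)

/-- **Open inputs, geometric form.**  The record `U.OpenInputs` with its two CM-side fields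
`pohlmann_span : U.PohlmannSpan` and `qw8_sufficiency : U.Qw8Sufficiency` REPLACED by the nine standard
facts from which they are theorems (`pohlmannSpan_of_facts`, `qw8Sufficiency_of_geometricFacts`).  What is
asserted outright here is: the two theta-realisation inputs of PerL v5 / rfwf v3 (unchanged, the PerL
seats' targets) and nine textbook facts about products of CM abelian varieties (Künneth in degree ≤ 1 and
for `H⁰`, Hodge decomposition of cup products and of `F⁰`, factor actions on block products, cup product
preserves algebraic classes, associativity of cup product, perfectness of Poincaré duality on weight
spaces, Gysin maps of block projections) — FACTS.md rows N1–N4, F2, F4–F7 with page-level citations. -/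
structure OpenInputsGeometric : Prop where
  /-- PerL v5 §§3–4: the theta realisation exists in the PerL setting (unchanged open input). -/
  realisation_perL : U.RealisationExistsPerL
  /-- rfwf v3 §4.2: the theta realisation exists over a Galois CM field and any rank-four face
  (unchanged open input). -/
  realisation_face : U.RealisationExistsFace
  /-- N1 `Fact_cupExterior` (Geometry/CupFacts.lean). -/
  cupExterior : U.Fact_cupExterior
  /-- N2 `Fact_cup_hodge`. -/
  cup_hodge : U.Fact_cup_hodge
  /-- N3 `Fact_pull_H0`. -/
  pull_H0 : U.Fact_pull_H0
  /-- N4 `Fact_hodge_F0`. -/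
  hodge_F0 : U.Fact_hodge_F0
  /-- F2 `Fact_factorActDescends` (StubTree/Qw8Geometric.lean). -/
  factorActDescends : U.Fact_factorActDescends
  /-- F4 `Fact_cupAlg`. -/
  cupAlg : U.Fact_cupAlg
  /-- F5 `Fact_cupAssoc`. -/
  cupAssoc : U.Fact_cupAssoc
  /-- F6 `Fact_weightDual` (v7, two-sided, non-normalised). -/
  weightDual : U.Fact_weightDual
  /-- F7 `Fact_gysin`. -/
  gysin : U.Fact_gysin

/-- **The old record from the geometric one**: `pohlmann_span` and `qw8_sufficiency` are theorems of the
model axioms and the nine facts. -/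
theorem openInputs_of_geometricFacts (M : U.ModelAxioms) (I : U.OpenInputsGeometric) :
    U.OpenInputs where
  realisation_perL := I.realisation_perL
  realisation_face := I.realisation_face
  pohlmann_span := U.pohlmannSpan_of_facts M I.cupExterior I.cup_hodge I.pull_H0 I.hodge_F0
  qw8_sufficiency :=
    U.qw8Sufficiency_of_geometricFacts M I.cupExterior I.cup_hodge I.pull_H0 I.hodge_F0
      I.factorActDescends I.cupAlg I.cupAssoc I.weightDual I.gysin

end Universe

namespace Assembly

variable (U : Universe)

/-- **COR-CM from the geometric record**: model axioms + `RealisationExistsFace` + nine standard facts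
(the `realisation_perL` field is not used). -/
theorem COR_CM_of_openInputsGeometric (M : U.ModelAxioms) (I : U.OpenInputsGeometric) : U.HC_CM :=
  COR_CM_of_openInputs U M (U.openInputs_of_geometricFacts M I)

/-- **PerL from the geometric record** (only `realisation_perL` is used; recorded for symmetry with
`perL_of_openInputs`). -/
theorem perL_of_openInputsGeometric (M : U.ModelAxioms) (I : U.OpenInputsGeometric) : U.PerL :=
  perL_of_openInputs U M (U.openInputs_of_geometricFacts M I)

end Assembly

end HodgeCM

end
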